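import Summits.BirchSwinnertonDyer.BirchSwinnertonDyer.Theorems.ManinOddAtFour.Negative.KatoNeronIntegralTwoGamma1OptimalOfOddAtFour
import HarnessLib
import HarnessLib.Audit.Tags

/-!
# THE REAL-CUSPIDAL-2-CLASS LOCUS OF THE Γ₁ KATO ROAD — row E-es-122 `KatoNeronIntegralTwoGamma1OptimalReal` ⟺ `GammaOneOddAtFourReal`
# typed next to E-es-110, with the kernel-checked split of C2¹ along the locus (cell `bsd-f2-manin`, planner `es` g26, MEMO-es §40;
# T-es-38; nothing asserted)

TYPER NOTE (typer g18, T-es-38).  SOURCE = HOME/es/g26/Sketch-es-g26.lean sha16 c4ff8f095a9a9157 (143 l.; farm rc 0 · 0 err · 0 warn · 0 sorry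
per es; BC7 Probe-es-g26.lean 06087b36097eb0f0 → 6/6 CLEAN), landed VERBATIM as a SIBLING of `GammaOneKatoRoad.lean` (E-es-110/112 live there;
this file adds ONE binder to them) except: (i) this note; (ii) namespace `BsdF2ManinEsG26` folded to `…ManinAdditive.KatoCurve` (the namespace
of E-es-110/111/112); (iii) `@[conjecture]` attributes on the four obligation nodes (es's ask: E-es-122 in both forms; and the two halves of
the split of the `@[conjecture]` node `ShimuraLedger.GammaOneOddOnBlindClasses`) — NOTHING asserted; nothing else changed.  The single import
`Theorems.ManinOddAtFour.Negative.KatoNeronIntegralTwoGamma1OptimalOfOddAtFour` imports no Theses or Cruxes module (transitive-import check), so this leaf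
is ROUTE-INDEPENDENT.  es sequenced this landing AFTER ref1's audit of LEMMA R′; that audit is §R133 (R-es-57): PASS (1)–(6) on paper,
E-es-122 = LAW with an audited proof plan, beyond-print theorem CANDIDATE (conditional on the chain's bookkeeping MEMO-es §40.12 (iv)), KILLED 0;
§R134-pre «`CuspidalTwoClassReal` is well posed» (R-es-58 (ii)).

CONTENT.  §1 `CuspidalTwoClassReal f` — the cuspidal 2-class `Φ₁ = (𝓛̄_f/Λ₁(f))[2^∞] = ker(E₁ → E_K)[2^∞]` is REAL (f-intrinsic, decidable
per class by exact modular symbols).  §2 **E-es-122** in Kato form `KatoNeronIntegralTwoGamma1OptimalReal` (= E-es-110 with the extra binder)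
and in Manin-constant form `GammaOneOddAtFourReal` (= E-es-112 with the extra binder), PROVED equivalent over the tree (`katoReal_iff_oddReal`:
es's lever `not_two_dvd_maninConstant₁_of_katoFact_of_witness` + p2's `twoAdicGammaOneWitnessLaw_holds` one way, the Negative file's
`katoFactTwoAt_of_not_two_dvd_maninConstant` the other), with the weakenings `katoReal_of_kato` (E-es-110 ⟹) and `oddReal_of_odd` (E-es-112 ⟹).
§3 the kernel-checked SPLIT of C2¹ `ShimuraLedger.GammaOneOddOnBlindClasses` into its real part `GammaOneOddOnRealBlindClasses`
(⟸ E-es-122, `gammaOneOddOnRealBlindClasses_of`) and the non-real residual `GammaOneOddOnNonRealBlindClasses` (census E40: 1/21 blind classes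
≤ 5000 — 32a1, CM, j = 1728), `gammaOneOddOnBlindClasses_of_split` / `split_of_gammaOneOddOnBlindClasses` / `gammaOneOddOnBlindClasses_of_katoReal`.

HONEST FRAMING.  LENS: es (Euler system / explicit reciprocity).  NOT IN PRINT: LEMMA R′ «the Eisenstein (Gysin) boundary of an EVEN non-trivial
twist vanishes on REAL cuspidal 2-classes, so Kato's resolvent classes lift from `T₂E_K` to the OPTIMAL `X₁`-lattice with NO image hypothesis»
(MEMO-es §40.2–40.3; inputs printed: Gysin/purity, cusps over `ℚ(ζ_N)`, Brumer 1967 = Washington Thm 5.25 / Cor 5.32 (Leopoldt for abelian fields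
at p = 2), Shapiro–Mackey, Herbrand) + PROP K (§39.2, ref1 §R123 (a) PASS) + E-es-115(α) + E-es-111 (tree theorem) ⟹ `2 ∤ c₁` on the locus.  es's
searches (corpus fts + vec, galaxy all/pdf, labelled in MEMO-es §40.9): no print statement of the even-twist boundary vanishing / the lift to the
X₁-optimal lattice; NEAREST PRINT BY NAME: [Wuthrich2014 §3 / Thm 13] (integrality of Kato's classes in `T₂E` for symbol-closure-type lattices),
[Kato2004Asterisque §7.13–7.16, (8.1.2)–(8.1.3), Thm 12.5] (Betti-side boundary, the zeta elements at p = 2), [Stevens1989 §2] (c₁).  WHY NOVEL (es):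
a modular-parametrisation-side lemma (reality of the cuspidal 2-class) replaces the big-image hypothesis of the Euler-system road at p = 2.
BC5 WITNESS: HOME/es/g26/E40-REALCUSP2CLASS-v1.tsv sha16 606cb65c77a4c493 (engine e40_realcusp.py 6ac3293d20af2312; inputs POLAR-N5000 3b0eeb7a71360859 +
Cremona allisog): the locus is TRUE on 20/21 totally-blind classes `4 ∣ N ≤ 5000` (`Φ₁ = E₁[2]`, `Δ(E₁) > 0` on 19; 40a1: `Φ₁ ≅ ℤ/4 × ℤ/2` real;
32a1 NON-real, CM), `c₁ = 1` on 21/21 — meets 20, beyond-print 20, violations 0.  CHEAPEST FALSIFIER: a class in the locus with `2 ∣ c₁` — none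
(`c₁ = 1` throughout Cremona's range); LEMMA R′ is falsifiable only by audit (ref1 §R133: PASS).  SCOPE (es §40.12 / E-es-123, ref1 §R133): on the
HALF-HOMOTHETY locus (17/21) stub 6′ is already print (F-es-21♭K) + E-es-123, so R′/E-es-122 carries content on the real NON-half-homothetic classes
(40a1-type).  REFUTER VERDICTS: ref1 §R133 (R-es-57) LEMMA R′ SURVIVES, E-es-122 LAW / beyond-print CANDIDATE, KILLED 0; ref2 placement PENDING.
PARTITION currency: C2¹ = real part (⟸ E-es-122) ⊔ non-real residual (32a-type); no RES class moves today; beyond-print theorem: NO (candidate);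
bears_on: stmt-BirchSwinnertonDyer-22967 (C2) via stub 6′ / C2¹.  BSD is not proved by this; Manin's conjecture is not proved; c₀ = c₁ = 1 is not
proved; C2/C3 OPEN.
[cite: Kato2004Asterisque, (8.1.2)–(8.1.3) (p. 180) and Thm. 12.5 (1) (p. 221) (zeta elements and the p = 2 explicit reciprocity law; shape only — LEMMA R′ and E-es-122 are the cell's, MEMO-es §40, NOT in print)]
[cite: Wuthrich2014, §3 and Thm. 13 (integrality of Kato's Euler system in T_pE; nearest print)]
[cite: Stevens1989, §2 (the X₁(N)-optimal curve and c₁; shape only)]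
[cite: ConradEdixhovenStein2003, §6.1 (the Γ₁(N) parametrisation and Stevens' conjecture; shape only)]
-/

noncomputable section

open scoped Classical MatrixGroups ModularForm ComplexConjugate
open CongruenceSubgroup Complex WeierstrassCurve Literature.NumberTheory.EllipticCurves
open Literature.NumberTheory.EllipticCurves.ModularForms
open Summit.BirchSwinnertonDyer.Rank1Residual.ManinAdditive
open Summit.BirchSwinnertonDyer.Rank1Residual.ManinAdditive.KatoCurve
open Summit.BirchSwinnertonDyer.BirchSwinnertonDyer.Theorems.ManinLocalTwoThree
open Summit.BirchSwinnertonDyer.BirchSwinnertonDyer.Theorems.ManinLocalTwoThree.GammaOneKatoRoad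
open Summit.BirchSwinnertonDyer.BirchSwinnertonDyer.Theorems.ManinOddAtFour.Negative

namespace Summit.BirchSwinnertonDyer.Rank1Residual.ManinAdditive.KatoCurve

/-! ## §1 The locus: reality of the cuspidal 2-class -/

/-- **`CuspidalTwoClassReal f`** — the CUSPIDAL 2-CLASS of `f` is REAL: every modular symbol `w ∈ 𝓛̄_f`
(`AddSubgroup.closure (Set.range (modularSymbol f))`, all `{∞,r}_f`) whose class in `𝓛̄_f/Λ₁(f)` is `2`-power torsion
satisfies `w̄ − w ∈ Λ₁(f)` (`Λ₁(f) = periodLatticeGamma1 f`).  For the `X₁(N)`-optimal curve `E₁ = ℂ/c₁Λ₁(f)` this says: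
the `2`-primary part `Φ₁` of the image of the cuspidal divisor classes of `X₁(N)` in `E₁` (= `ker(E₁ → E_K)[2^∞]`,
`E_K = ℂ/c₁𝓛̄_f` the symbol-closure curve) consists of REAL points.  f-intrinsic, decidable per class by exact modular
symbols; census E40 (HOME/es/g26/E40-REALCUSP2CLASS-v1.tsv): TRUE on 20/21 blind classes `4 ∣ N ≤ 5000` (all but 32a1). -/
def CuspidalTwoClassReal {N : ℕ} (f : CuspForm (Gamma0 N) 2) : Prop :=
  ∀ w ∈ AddSubgroup.closure (Set.range (modularSymbol f)),
    (∃ k : ℕ, (2 : ℂ) ^ k * w ∈ periodLatticeGamma1 f) → conj w - w ∈ periodLatticeGamma1 f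

/-! ## §2 E-es-122: E-es-110 / E-es-112 restricted to the real locus -/

/-- **E-es-122 (Kato form) `KatoNeronIntegralTwoGamma1OptimalReal`**: `KatoFactTwoAt V D₁.f` for every OPTIMAL
`X₁(N)`-datum whose cuspidal 2-class is real.  = E-es-110 `KatoNeronIntegralTwoGamma1Optimal` with ONE extra binder.
es claim (MEMO-es §40): ⟸ Kato 2004 (8.1.3)/Thm 12.5–12.6 at `p = 2` [print] + LEMMA R′ [new, soft: Gysin + Brumer–Leopoldt +
reality] + PROP K (§39.2) [standard local duality; audit R-es-56 pending] + E-es-115(α) [cell theorem] + E-es-111 [tree theorem]. -/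
@[conjecture]
def KatoNeronIntegralTwoGamma1OptimalReal : Prop :=
  ∀ (V : WeierstrassCurve ℚ) [V.IsElliptic] [V.IsGloballyMinimal] {N : ℕ} [NeZero N]
    (D₁ : Gamma1ParametrizationData V N), D₁.IsOptimal → CuspidalTwoClassReal D₁.f → KatoFactTwoAt V D₁.f

/-- **E-es-122 (Manin-constant form) `GammaOneOddAtFourReal`**: `2 ∤ c₁` for every optimal `X₁(N)`-datum additive at `2`
whose cuspidal 2-class is real (Stevens' Conjecture I′, 2-part, additive case, on the real-cuspidal-2-class locus). -/
@[conjecture]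
def GammaOneOddAtFourReal : Prop :=
  ∀ (V : WeierstrassCurve ℚ) [V.IsElliptic] [V.IsGloballyMinimal] {N : ℕ} [NeZero N]
    (D₁ : Gamma1ParametrizationData V N), D₁.IsOptimal →
    ¬ V.HasGoodReductionAtPrime 2 → ¬ V.HasMultiplicativeReductionAtPrime 2 →
    CuspidalTwoClassReal D₁.f → ¬ (2 : ℤ) ∣ D₁.maninConstant

/-- E-es-122 (Kato form) ⟹ E-es-122 (c₁ form): es's lever fed with p2's theorem `twoAdicGammaOneWitnessLaw_holds`. -/
theorem gammaOneOddAtFourReal_of (h : KatoNeronIntegralTwoGamma1OptimalReal) : GammaOneOddAtFourReal := by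
  intro V _ _ N _ D₁ hopt hg hmu hreal
  exact not_two_dvd_maninConstant₁_of_katoFact_of_witness V D₁ hopt (h V D₁ hopt hreal) hg hmu
    (twoAdicGammaOneWitnessLaw_holds V D₁ hopt hg hmu)

/-- E-es-122 (c₁ form) ⟹ E-es-122 (Kato form): the Negative file's lattice computation. -/
theorem katoReal_of_oddReal (h : GammaOneOddAtFourReal) : KatoNeronIntegralTwoGamma1OptimalReal := by
  intro V _ _ N _ D₁ hopt hreal hVf hg hmu m _ hcop χ hprim hne hodd h8 ϖ r hϖ hsum
  exact katoFactTwoAt_of_not_two_dvd_maninConstant V D₁ (h V D₁ hopt hg hmu hreal) hVf hg hmu m hcop χ hprim hne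
    hodd h8 ϖ r hϖ hsum

/-- **E-es-122: the two forms are EQUIVALENT over the tree.** -/
theorem katoReal_iff_oddReal : KatoNeronIntegralTwoGamma1OptimalReal ↔ GammaOneOddAtFourReal :=
  ⟨gammaOneOddAtFourReal_of, katoReal_of_oddReal⟩

/-- E-es-110 ⟹ E-es-122 (trivial weakening; E-es-122 is STRICTLY inside E-es-110's scope: 32a1 is outside). -/
theorem katoReal_of_kato (h : KatoNeronIntegralTwoGamma1Optimal) : KatoNeronIntegralTwoGamma1OptimalReal :=
  fun V _ _ _ _ D₁ hopt _ => h V D₁ hopt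

/-- E-es-112 ⟹ E-es-122 (c₁ form). -/
theorem oddReal_of_odd (h : GammaOneOddAtFour) : GammaOneOddAtFourReal :=
  fun V _ _ _ _ D₁ hopt hg hmu _ => h V D₁ hopt hg hmu

/-! ## §3 The kernel-checked SPLIT of C2¹ along the locus -/

/-- **C2¹ on the REAL blind classes**: `ShimuraLedger.GammaOneOddOnBlindClasses` with the extra binder
`CuspidalTwoClassReal D₁.f` (census E40: 20/21 blind classes `≤ 5000`). -/
@[conjecture]
def GammaOneOddOnRealBlindClasses : Prop :=
  ∀ (W₁ W₀ : WeierstrassCurve ℚ) [W₁.IsElliptic] [W₁.IsGloballyMinimal] [W₀.IsElliptic] [W₀.IsGloballyMinimal]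
    {N : ℕ} [NeZero N] (D₁ : Gamma1ParametrizationData W₁ N) (D₀ : ModularParametrizationData W₀ N),
    IsIsogenous W₁ W₀ → D₁.IsOptimal → (∀ z ∈ D₀.L.lattice, ∃ w ∈ periodLattice D₀.f, z = D₀.c * w) →
    2 ^ 2 ∣ N → W₀.a₁ = 0 → W₀.a₃ = 0 → ShimuraLedger.HasRationalTwoTorsion W₀ →
    ShimuraLedger.AllRationalTwoTorsionBlind W₀ → CuspidalTwoClassReal D₁.f →
    ¬ (2 : ℤ) ∣ D₁.maninConstant

/-- **The NON-REAL residual of C2¹** (census E40: 1/21, the CM class 32a — where LEMMA R′ is silent). -/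
@[conjecture]
def GammaOneOddOnNonRealBlindClasses : Prop :=
  ∀ (W₁ W₀ : WeierstrassCurve ℚ) [W₁.IsElliptic] [W₁.IsGloballyMinimal] [W₀.IsElliptic] [W₀.IsGloballyMinimal]
    {N : ℕ} [NeZero N] (D₁ : Gamma1ParametrizationData W₁ N) (D₀ : ModularParametrizationData W₀ N),
    IsIsogenous W₁ W₀ → D₁.IsOptimal → (∀ z ∈ D₀.L.lattice, ∃ w ∈ periodLattice D₀.f, z = D₀.c * w) →
    2 ^ 2 ∣ N → W₀.a₁ = 0 → W₀.a₃ = 0 → ShimuraLedger.HasRationalTwoTorsion W₀ →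
    ShimuraLedger.AllRationalTwoTorsionBlind W₀ → ¬ CuspidalTwoClassReal D₁.f →
    ¬ (2 : ℤ) ∣ D₁.maninConstant

/-- E-es-122 (c₁ form) ⟹ the real part of C2¹ (the blind-class binders are idle except `2² ∣ N` ⟹ additive at 2). -/
theorem gammaOneOddOnRealBlindClasses_of (h : GammaOneOddAtFourReal) : GammaOneOddOnRealBlindClasses := by
  intro W₁ W₀ _ _ _ _ N _ D₁ D₀ _ hopt _ h4 _ _ _ _ hreal
  haveI : Fact (Nat.Prime 2) := ⟨Nat.prime_two⟩
  obtain ⟨hg, hmu⟩ := additive_of_sq_dvd_level 2 W₁ D₁.f D₁.isNewformOf h4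
  exact h W₁ D₁ hopt hg hmu hreal

/-- **C2¹ = (real part) ∧ (non-real residual)** — kernel-checked recut of C2 v15 stub 6′'s target BY NAME. -/
theorem gammaOneOddOnBlindClasses_of_split
    (hr : GammaOneOddOnRealBlindClasses) (hn : GammaOneOddOnNonRealBlindClasses) :
    ShimuraLedger.GammaOneOddOnBlindClasses := by
  intro W₁ W₀ _ _ _ _ N _ D₁ D₀ hiso hopt hopt₀ h4 ha₁ ha₃ hT hblind
  by_cases hreal : CuspidalTwoClassReal D₁.f
  · exact hr W₁ W₀ D₁ D₀ hiso hopt hopt₀ h4 ha₁ ha₃ hT hblind hreal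
  · exact hn W₁ W₀ D₁ D₀ hiso hopt hopt₀ h4 ha₁ ha₃ hT hblind hreal

/-- Converse bookkeeping: C2¹ ⟹ both parts. -/
theorem split_of_gammaOneOddOnBlindClasses (h : ShimuraLedger.GammaOneOddOnBlindClasses) :
    GammaOneOddOnRealBlindClasses ∧ GammaOneOddOnNonRealBlindClasses :=
  ⟨fun W₁ W₀ _ _ _ _ _ _ D₁ D₀ hiso hopt hopt₀ h4 ha₁ ha₃ hT hblind _ =>
      h W₁ W₀ D₁ D₀ hiso hopt hopt₀ h4 ha₁ ha₃ hT hblind,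
    fun W₁ W₀ _ _ _ _ _ _ D₁ D₀ hiso hopt hopt₀ h4 ha₁ ha₃ hT hblind _ =>
      h W₁ W₀ D₁ D₀ hiso hopt hopt₀ h4 ha₁ ha₃ hT hblind⟩

/-- **Stub 6′ recut for the C2 LEAD (by name):** E-es-122 (Kato form) ∧ the non-real residual ⟹ C2¹. -/
theorem gammaOneOddOnBlindClasses_of_katoReal
    (h122 : KatoNeronIntegralTwoGamma1OptimalReal) (hn : GammaOneOddOnNonRealBlindClasses) :
    ShimuraLedger.GammaOneOddOnBlindClasses :=
  gammaOneOddOnBlindClasses_of_split (gammaOneOddOnRealBlindClasses_of (gammaOneOddAtFourReal_of h122)) hn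

end Summit.BirchSwinnertonDyer.Rank1Residual.ManinAdditive.KatoCurve

end
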